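import Literature.NumberTheory.Automorphic.ArchRankinSelbergIntegrableGL2
import HarnessLib

/-!
# Humphries–Jo's archimedean test vector theorem in rank two: the absolute-convergence clause

Topic `NumberTheory/Automorphic`; namespace `Literature.NumberTheory.Automorphic`. Proof file
(theorems only) under the named fact `HumphriesJo2024_archRankinSelberg_testVector`
(`ArchRankinSelbergTestVector`; sibling of `ArchRankinSelbergTestVectorRankOne`). The fact is a
conjunction (i) ∧ (ii): (i) the existence of `K_∞`-finite test vectors realising
`c^s ∏ Γ_ℝ(s + a_j) ∏ Γ_ℂ(s + b_j)` (Humphries–Jo (2024), Thm. 1.1 / Thm. 5.6 — in rank `2` the explicit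
Bessel–Mellin analysis of `GL₂(ℝ)`, `GL₂(ℂ)`, NOT in the tree), and (ii) the absolute convergence of
the archimedean Rankin–Selberg integrals `Ψ_∞(s; W_e, W̄'_{e'}, Φ_∞)` for all `K_∞`-finite Gårding
`e, e'`, every polynomial-times-Gaussian `Φ_∞` and `re s > 1` (Jacquet–Shalika (1981), §3–§4; Cogdell
(2004), §3.1 (1), §3.2). This file PROVES clause (ii) in rank `2` for every number field:

* `HumphriesJo2024_archRankinSelberg_testVector_two_integrable` (**main**) — clause (ii) of
  `HumphriesJo2024_archRankinSelberg_testVector 2 K`, verbatim: continuity of the integrand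
  (`continuous_apply_toArch_functional`, the polynomial-times-Gaussian read in the coordinates
  `c · row₂(k)`, `continuous_archTorusWeightC`), `|W W̄'| ≤ |W|² + |W'|²`, and the mirabolic reduction
  `lintegral_whittaker_sq_polyGaussian_lt_top` of `ArchRankinSelbergIntegrableGL2` (weighted Kirillov
  bound on `K_∞`-orbits, Gaussian domination, torus coordinates `y = c · (u, 1)`) for `τ` and for `τ'`;
* `HumphriesJo2024_archRankinSelberg_testVector_two_of_gammaIdentity` — hence the rank-two fact
  follows from its clause (i) alone (spelled out as a hypothesis): the open archimedean input is
  exactly the Γ-product evaluation at some `K_∞`-finite test vectors.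

## References

* P. Humphries, Y. Jo, *Test vectors for archimedean period integrals*, Publ. Mat. 68 (2024),
  Thm. 1.1, Prop. 5.2, Thm. 5.6 [HumphriesJo2024].
* H. Jacquet, J. A. Shalika, *On Euler products and the classification of automorphic
  representations I*, Amer. J. Math. 103 (1981), §3 (3.16), §4 [JacquetShalikaAJM1981].
* J. W. Cogdell, *Analytic theory of L-functions for GL_n* (2004), §3.1 (1), §3.2
  [CogdellAnalyticTheory2004].
-/

noncomputable section

open MeasureTheory Measure NumberField NumberField.mixedEmbedding NumberField.InfinitePlace IsDedekindDomain Set Filter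
open scoped MatrixGroups ENNReal NNReal Classical ComplexConjugate

namespace Literature.NumberTheory.Automorphic

-- as in `ArchGardingWhittaker` / `ArchKirillovMellinConvergenceGL2`
set_option backward.isDefEq.respectTransparency false

variable {K : Type} [Field K] [NumberField K]

section Integrable

variable (K) in
set_option maxHeartbeats 4000000 in
/-- **Clause (ii) of Humphries–Jo's archimedean test-vector fact in rank `2`, PROVED** — the absolute
convergence of the archimedean `GL₂ × GL₂` Rankin–Selberg integrals for unitary data (Jacquet–Shalika
(1981), §3–§4; Cogdell (2004), §3.1 item (1), §3.2): for irreducible unitary strongly continuous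
`τ, τ'` on `GL₂(K_∞)` with continuous `ψ_∞`-Whittaker functionals `ℓ, ℓ'`, Haar measures `μA, μK`,
`K_∞`-finite Gårding vectors `e, e'`, a polynomial-times-Gaussian `Φ_∞` and `re s > 1`, the integrand
`ℓ(τ(diag(y) k) e) · conj ℓ'(τ'(diag(y) k) e') · Φ_∞(e₂ diag(y) k) · |det y|^s δ_B(y)⁻¹` of
`Ψ_∞(s; W_e, W̄'_{e'}, Φ_∞)` is integrable for `μA × μK`. This is exactly the second conjunct of
`HumphriesJo2024_archRankinSelberg_testVector 2 K` (`ArchRankinSelbergTestVector`); the first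
(the Γ-product evaluation at `K_∞`-finite test vectors, Humphries–Jo (2024), Thm. 1.1 / Thm. 5.6) is
NOT proved in the tree (ranks `≥ 2`). Proof: continuity of the integrand, `|W W̄'| ≤ |W|² + |W'|²`,
and `lintegral_whittaker_sq_polyGaussian_lt_top` (`ArchRankinSelbergIntegrableGL2`) for `τ` and for `τ'`.
[cite: HumphriesJo2024, Thm. 1.1, Prop. 5.2, Thm. 5.6 (pp. 140, 151–153)]
[cite: JacquetShalikaAJM1981, §3 (3.16) and §4] [cite: CogdellAnalyticTheory2004, §3.1 item (1) and §3.2] -/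
theorem HumphriesJo2024_archRankinSelberg_testVector_two_integrable (hcpt : isCompact_glFiniteIntegralLevel 2 K)
    (E : Type) [NormedAddCommGroup E] [InnerProductSpace ℂ E] [CompleteSpace E]
    (τ : ContRepresentation ℂ (AutomorphyDatum.gl 2 K hcpt).arch.carrier E) (hτ : τ.IsStronglyContinuous)
    (hτu : τ.IsUnitary) (hτi : τ.IsTopIrreducible)
    (ℓ : archGardingSpace hcpt τ →ₗ[ℂ] ℂ) (hℓ : IsArchContWhittakerFunctional hcpt τ hτ ℓ)
    (E' : Type) [NormedAddCommGroup E'] [InnerProductSpace ℂ E'] [CompleteSpace E']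
    (τ' : ContRepresentation ℂ (AutomorphyDatum.gl 2 K hcpt).arch.carrier E') (hτ' : τ'.IsStronglyContinuous)
    (hτu' : τ'.IsUnitary) (hτi' : τ'.IsTopIrreducible)
    (ℓ' : archGardingSpace hcpt τ' →ₗ[ℂ] ℂ) (hℓ' : IsArchContWhittakerFunctional hcpt τ' hτ' ℓ')
    [MeasurableSpace (GL (Fin 2) (mixedSpace K))] [BorelSpace (GL (Fin 2) (mixedSpace K))]
    [mU : MeasurableSpace ((mixedSpace K)ˣ)] [hmU : BorelSpace ((mixedSpace K)ˣ)]
    (μA : Measure (Fin 2 → (mixedSpace K)ˣ)) (hμA : IsHaarMeasure μA)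
    (μK : Measure ↥(Kinf 2 K)) (hμK : IsHaarMeasure μK)
    (e : archGardingSpace hcpt τ) (e' : archGardingSpace hcpt τ')
    (he : FiniteDimensional ℂ (Submodule.span ℂ (Set.range
      fun κ : (AutomorphyDatum.gl 2 K hcpt).arch.maximalCompact => τ (toArch hcpt (κ : GL (Fin 2) (mixedSpace K))) (e : E))))
    (he' : FiniteDimensional ℂ (Submodule.span ℂ (Set.range
      fun κ : (AutomorphyDatum.gl 2 K hcpt).arch.maximalCompact => τ' (toArch hcpt (κ : GL (Fin 2) (mixedSpace K))) (e' : E'))))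
    (Φinf : (Fin 2 → InfiniteAdeleRing K) → ℂ) (hΦ : IsArchPolyGaussian 2 K Φinf) (s : ℂ) (hs : 1 < s.re) :
    Integrable (fun p : (Fin 2 → (mixedSpace K)ˣ) × ↥(Kinf 2 K) =>
        ℓ ⟨τ (toArch hcpt (glDiagonal 2 (mixedSpace K) p.1 * (p.2 : GL (Fin 2) (mixedSpace K)))) (e : E),
            apply_mem_archGardingSpace hτ _ e.2⟩ *
          conj (ℓ' ⟨τ' (toArch hcpt (glDiagonal 2 (mixedSpace K) p.1 * (p.2 : GL (Fin 2) (mixedSpace K))))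
            (e' : E'), apply_mem_archGardingSpace hτ' _ e'.2⟩) *
          Φinf (archLastRow 2 K (glDiagonal 2 (mixedSpace K) p.1 * (p.2 : GL (Fin 2) (mixedSpace K)))) *
          archTorusWeightC 2 K s p.1) (μA.prod μK) := by
  haveI := hμA
  haveI := hμK
  haveI : SecondCountableTopology (GL (Fin 2) (mixedSpace K)) := secondCountableTopology_glInf 2 K
  haveI : CompactSpace ↥(Kinf 2 K) := isCompact_iff_compactSpace.mp (isCompact_Kinf_holds 2 K)
  haveI : BorelSpace (Fin 2 → (mixedSpace K)ˣ) := Pi.borelSpace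
  -- the group element `g(y, k) = diag(y) k`
  set g : (Fin 2 → (mixedSpace K)ˣ) × ↥(Kinf 2 K) → GL (Fin 2) (mixedSpace K) := fun p =>
    glDiagonal 2 (mixedSpace K) p.1 * (p.2 : GL (Fin 2) (mixedSpace K)) with hg
  have hgc : Continuous g := continuous_glDiagonal_mul_kinf
  -- ### 1. continuity of the integrand
  have hW : Continuous fun p : (Fin 2 → (mixedSpace K)ˣ) × ↥(Kinf 2 K) =>
      ℓ ⟨τ (toArch hcpt (g p)) (e : E), apply_mem_archGardingSpace hτ _ e.2⟩ :=
    continuous_apply_toArch_functional hτ hℓ.norm_le e.2 hgc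
  have hW' : Continuous fun p : (Fin 2 → (mixedSpace K)ˣ) × ↥(Kinf 2 K) =>
      ℓ' ⟨τ' (toArch hcpt (g p)) (e' : E'), apply_mem_archGardingSpace hτ' _ e'.2⟩ :=
    continuous_apply_toArch_functional hτ' hℓ'.norm_le e'.2 hgc
  obtain ⟨Nq, L, q, T, hΦL⟩ := id hΦ
  set Φt : (Fin 2 → mixedSpace K) → ℂ := fun x =>
    MvPolynomial.eval (fun i => ((L i x : ℝ) : ℂ)) q * ((Real.exp (-‖T x‖ ^ 2) : ℝ) : ℂ) with hΦt
  have hΦtc : Continuous Φt := by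
    refine Continuous.mul ?_ ?_
    · exact (MvPolynomial.continuous_eval q).comp
        (continuous_pi fun i => Complex.continuous_ofReal.comp (L i).continuous)
    · exact Complex.continuous_ofReal.comp (Real.continuous_exp.comp (T.continuous.norm.pow 2).neg)
  have hΦeq : ∀ p : (Fin 2 → (mixedSpace K)ˣ) × ↥(Kinf 2 K), Φinf (archLastRow 2 K (g p)) =
      Φt (fun j => ((p.1 (Fin.last 1) : (mixedSpace K)ˣ) : mixedSpace K) *
        ((p.2 : GL (Fin 2) (mixedSpace K)) : Matrix (Fin 2) (Fin 2) (mixedSpace K)) (Fin.last 1) j) := by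
    intro p
    change Φinf (archLastRow 2 K (glDiagonal 2 (mixedSpace K) p.1 * (p.2 : GL (Fin 2) (mixedSpace K)))) = _
    rw [archLastRow_glDiagonal_mul (n := 1), hΦL]
    simp only [RingEquiv.apply_symm_apply]
    rfl
  have hΦc : Continuous fun p : (Fin 2 → (mixedSpace K)ˣ) × ↥(Kinf 2 K) => Φinf (archLastRow 2 K (g p)) := by
    have hfun : (fun p : (Fin 2 → (mixedSpace K)ˣ) × ↥(Kinf 2 K) => Φinf (archLastRow 2 K (g p))) =
        fun p => Φt (fun j => ((p.1 (Fin.last 1) : (mixedSpace K)ˣ) : mixedSpace K) *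
          ((p.2 : GL (Fin 2) (mixedSpace K)) : Matrix (Fin 2) (Fin 2) (mixedSpace K)) (Fin.last 1) j) :=
      funext hΦeq
    rw [hfun]
    refine hΦtc.comp (continuous_pi fun j => ?_)
    exact (Units.continuous_val.comp ((continuous_apply (Fin.last 1)).comp continuous_fst)).mul
      (Continuous.matrix_elem (Units.continuous_val.comp (continuous_subtype_val.comp continuous_snd)) (Fin.last 1) j)
  have hwt : Continuous fun p : (Fin 2 → (mixedSpace K)ˣ) × ↥(Kinf 2 K) => archTorusWeightC 2 K s p.1 :=
    (continuous_archTorusWeightC (n := 2) (K := K) s).comp continuous_fst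
  have hcont : Continuous fun p : (Fin 2 → (mixedSpace K)ˣ) × ↥(Kinf 2 K) =>
      ℓ ⟨τ (toArch hcpt (g p)) (e : E), apply_mem_archGardingSpace hτ _ e.2⟩ *
        conj (ℓ' ⟨τ' (toArch hcpt (g p)) (e' : E'), apply_mem_archGardingSpace hτ' _ e'.2⟩) *
        Φinf (archLastRow 2 K (g p)) * archTorusWeightC 2 K s p.1 :=
    ((hW.mul (Complex.continuous_conj.comp hW')).mul hΦc).mul hwt
  refine ⟨hcont.aestronglyMeasurable, hasFiniteIntegral_iff_enorm.2 ?_⟩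
  -- ### 2. finiteness: `|W W̄' Φ wt| ≤ (|W|² + |W'|²) |Φ| |wt|`
  have h1 := lintegral_whittaker_sq_polyGaussian_lt_top hτ hτu hτi hℓ e he Φinf hΦ hs.le μA μK
  have h2 := lintegral_whittaker_sq_polyGaussian_lt_top hτ' hτu' hτi' hℓ' e' he' Φinf hΦ hs.le μA μK
  set G : (Fin 2 → (mixedSpace K)ˣ) × ↥(Kinf 2 K) → ℝ≥0∞ := fun p =>
    ENNReal.ofReal (‖Φinf (archLastRow 2 K (g p))‖ * archTorusWeight 2 K s.re p.1) with hG
  set A : (Fin 2 → (mixedSpace K)ˣ) × ↥(Kinf 2 K) → ℝ≥0∞ := fun p =>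
    ‖ℓ ⟨τ (toArch hcpt (g p)) (e : E), apply_mem_archGardingSpace hτ _ e.2⟩‖ₑ ^ 2 * G p with hA
  set A' : (Fin 2 → (mixedSpace K)ˣ) × ↥(Kinf 2 K) → ℝ≥0∞ := fun p =>
    ‖ℓ' ⟨τ' (toArch hcpt (g p)) (e' : E'), apply_mem_archGardingSpace hτ' _ e'.2⟩‖ₑ ^ 2 * G p with hA'
  have hAm : AEMeasurable A (μA.prod μK) := by
    refine Measurable.aemeasurable ?_
    refine (((ENNReal.continuous_pow 2).comp hW.enorm).measurable).mul ?_
    exact ENNReal.measurable_ofReal.comp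
      (hΦc.norm.mul ((continuous_archTorusWeight (n := 2) (K := K) s.re).comp continuous_fst)).measurable
  -- `a b ≤ a² + b²` in `ℝ≥0∞`
  have hab : ∀ a b : ℝ≥0∞, a * b ≤ a ^ 2 + b ^ 2 := fun a b => by
    rcases le_total a b with h | h
    · calc a * b ≤ b * b := mul_le_mul' h le_rfl
        _ = b ^ 2 := (sq b).symm
        _ ≤ a ^ 2 + b ^ 2 := le_add_self
    · calc a * b ≤ a * a := mul_le_mul' le_rfl h
        _ = a ^ 2 := (sq a).symm
        _ ≤ a ^ 2 + b ^ 2 := le_self_add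
  have hle : ∀ p : (Fin 2 → (mixedSpace K)ˣ) × ↥(Kinf 2 K),
      ‖ℓ ⟨τ (toArch hcpt (g p)) (e : E), apply_mem_archGardingSpace hτ _ e.2⟩ *
        conj (ℓ' ⟨τ' (toArch hcpt (g p)) (e' : E'), apply_mem_archGardingSpace hτ' _ e'.2⟩) *
        Φinf (archLastRow 2 K (g p)) * archTorusWeightC 2 K s p.1‖ₑ ≤ A p + A' p := by
    intro p
    rw [enorm_mul, enorm_mul, enorm_mul]
    have hconj : ‖conj (ℓ' ⟨τ' (toArch hcpt (g p)) (e' : E'), apply_mem_archGardingSpace hτ' _ e'.2⟩)‖ₑ =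
        ‖ℓ' ⟨τ' (toArch hcpt (g p)) (e' : E'), apply_mem_archGardingSpace hτ' _ e'.2⟩‖ₑ := by
      rw [← ofReal_norm, Complex.norm_conj, ofReal_norm]
    have hGp : ‖Φinf (archLastRow 2 K (g p))‖ₑ * ‖archTorusWeightC 2 K s p.1‖ₑ = G p := by
      rw [hG, ← ofReal_norm, ← ofReal_norm, norm_archTorusWeightC, ← ENNReal.ofReal_mul (norm_nonneg _)]
    rw [hconj, mul_assoc, hGp]
    calc _ ≤ (‖ℓ ⟨τ (toArch hcpt (g p)) (e : E), apply_mem_archGardingSpace hτ _ e.2⟩‖ₑ ^ 2 +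
          ‖ℓ' ⟨τ' (toArch hcpt (g p)) (e' : E'), apply_mem_archGardingSpace hτ' _ e'.2⟩‖ₑ ^ 2) * G p :=
          mul_le_mul' (hab _ _) le_rfl
      _ = A p + A' p := add_mul _ _ _
  calc ∫⁻ p, ‖ℓ ⟨τ (toArch hcpt (g p)) (e : E), apply_mem_archGardingSpace hτ _ e.2⟩ *
        conj (ℓ' ⟨τ' (toArch hcpt (g p)) (e' : E'), apply_mem_archGardingSpace hτ' _ e'.2⟩) *
        Φinf (archLastRow 2 K (g p)) * archTorusWeightC 2 K s p.1‖ₑ ∂(μA.prod μK)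
      ≤ ∫⁻ p, A p + A' p ∂(μA.prod μK) := lintegral_mono hle
    _ = ∫⁻ p, A p ∂(μA.prod μK) + ∫⁻ p, A' p ∂(μA.prod μK) := lintegral_add_left' hAm _
    _ < ⊤ := ENNReal.add_lt_top.2 ⟨h1, h2⟩

variable (K) in
/-- **Reduction of the rank-two fact to its clause (i)**: `HumphriesJo2024_archRankinSelberg_testVector 2 K` follows
from its first clause alone — the Γ-product evaluation `Ψ_∞(s; W_e, W̄'_{e'}, Φ_∞) = c^s ∏ Γ_ℝ(s + a_j)
∏ Γ_ℂ(s + b_j)` at SOME `K_∞`-finite test vectors and polynomial-times-Gaussian (Humphries–Jo (2024),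
Thm. 1.1 with Prop. 5.2 / Thm. 5.6, the open archimedean Bessel–Mellin analysis of `GL₂(ℝ)`, `GL₂(ℂ)`),
spelled out as the hypothesis `h` — since clause (ii) is `HumphriesJo2024_archRankinSelberg_testVector_two_integrable`.
[cite: HumphriesJo2024, Thm. 1.1, Prop. 5.2, Thm. 5.6 (pp. 140, 151–153)] -/
theorem HumphriesJo2024_archRankinSelberg_testVector_two_of_gammaIdentity
    (h : ∀ (hcpt : isCompact_glFiniteIntegralLevel 2 K)
      (E : Type) [NormedAddCommGroup E] [InnerProductSpace ℂ E] [CompleteSpace E]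
      (τ : ContRepresentation ℂ (AutomorphyDatum.gl 2 K hcpt).arch.carrier E) (hτ : τ.IsStronglyContinuous)
      (_ : τ.IsUnitary) (_ : τ.IsTopIrreducible)
      (ℓ : archGardingSpace hcpt τ →ₗ[ℂ] ℂ) (_ : IsArchContWhittakerFunctional hcpt τ hτ ℓ) (_ : ℓ ≠ 0)
      (E' : Type) [NormedAddCommGroup E'] [InnerProductSpace ℂ E'] [CompleteSpace E']
      (τ' : ContRepresentation ℂ (AutomorphyDatum.gl 2 K hcpt).arch.carrier E') (hτ' : τ'.IsStronglyContinuous)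
      (_ : τ'.IsUnitary) (_ : τ'.IsTopIrreducible)
      (ℓ' : archGardingSpace hcpt τ' →ₗ[ℂ] ℂ) (_ : IsArchContWhittakerFunctional hcpt τ' hτ' ℓ') (_ : ℓ' ≠ 0)
      [MeasurableSpace (GL (Fin 2) (mixedSpace K))] [BorelSpace (GL (Fin 2) (mixedSpace K))]
      [MeasurableSpace ((mixedSpace K)ˣ)] [BorelSpace ((mixedSpace K)ˣ)]
      (μA : Measure (Fin 2 → (mixedSpace K)ˣ)) (_ : IsHaarMeasure μA)
      (μK : Measure ↥(Kinf 2 K)) (_ : IsHaarMeasure μK),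
      ∃ (e : archGardingSpace hcpt τ) (e' : archGardingSpace hcpt τ')
        (_ : FiniteDimensional ℂ (Submodule.span ℂ (Set.range
          fun κ : (AutomorphyDatum.gl 2 K hcpt).arch.maximalCompact => τ (toArch hcpt (κ : GL (Fin 2) (mixedSpace K))) (e : E))))
        (_ : FiniteDimensional ℂ (Submodule.span ℂ (Set.range
          fun κ : (AutomorphyDatum.gl 2 K hcpt).arch.maximalCompact => τ' (toArch hcpt (κ : GL (Fin 2) (mixedSpace K))) (e' : E'))))
        (Φinf : (Fin 2 → InfiniteAdeleRing K) → ℂ) (_ : IsArchPolyGaussian 2 K Φinf)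
        (c : ℝ) (_ : 0 < c) (d₁ d₂ : ℕ) (a : Fin d₁ → ℂ) (b : Fin d₂ → ℂ)
        (_ : ∀ j, -1 < (a j).re) (_ : ∀ j, -1 < (b j).re),
        ∀ s : ℂ, 1 < s.re →
          archRankinSelbergPairIntegralCplx hcpt τ hτ τ' hτ' ℓ ℓ' e e' Φinf μA μK s =
            (c : ℂ) ^ s * ((∏ j, Complex.Gammaℝ (s + a j)) * ∏ j, Complex.Gammaℂ (s + b j))) :
    HumphriesJo2024_archRankinSelberg_testVector 2 K := by
  intro hcpt E _ _ _ τ hτ hτu hτi ℓ hℓ hℓ0 E' _ _ _ τ' hτ' hτu' hτi' ℓ' hℓ' hℓ'0 mG hmG mU hmU μA hμA μK hμK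
  exact ⟨h hcpt E τ hτ hτu hτi ℓ hℓ hℓ0 E' τ' hτ' hτu' hτi' ℓ' hℓ' hℓ'0 μA hμA μK hμK,
    HumphriesJo2024_archRankinSelberg_testVector_two_integrable K hcpt E τ hτ hτu hτi ℓ hℓ E' τ' hτ' hτu' hτi' ℓ' hℓ' μA hμA μK hμK⟩

end Integrable

end Literature.NumberTheory.Automorphic
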